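import Literature.NumberTheory.Automorphic.JacquetLanglandsSurjectiveOfTraceComparison
import HarnessLib

/-!
# Jacquet–Langlands, "onto" half: the named residual (Gelbart's trace identity (10.10) for a
# cuspidal `π`, Hilbert–Schmidt form) and the assembly of `jacquetLanglands_transfer_surjective`

S. Gelbart, *Automorphic forms on adele groups*, Ann. of Math. Studies 83 (1975), §10: Thm. 10.5
(ii) ("`π' ↦ π` maps the constituents of `R'_ψ` … onto the constituents `⊗ π_v` of `R₀^ψ` such
that `π_v` is square-integrable for each `v ∈ S`") is proved on pp. 151–156 in two steps:

1. **the trace identity** (10.10) `tr τ(f ⋆ f^*) = tr τ'(f ⋆ f^*)` for `f` in the matched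
   `*`-algebra of test functions `Φ_f = ξ_S ⊗ f` / `Φ'_f = ξ'_S ⊗ f` ((10.11)–(10.13)), obtained by
   comparing the trace formula for the compact quotient of `D^×` (10.14) with the cuspidal trace
   formula for `GL₂` (10.15) term by term ((10.16)–(10.22), using the character identity (10.8) of
   the local correspondence Thm. 7.6 at `v ∈ S = Ram(D)`), together with the non-vanishing of
   `R₀(Φ_f)` on the constituent `π` under consideration ("`M ∩ π ≠ 0`", p. 152, local theory at `S`);
2. **Lemma 10.6** (= Jacquet–Langlands, LNM 114, Lemma 16.1.1): such a trace identity between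
   unitary representations forces an intertwiner, hence `τ ≅ τ'`.

Step 2 and everything representation-theoretic around it is PROVED in the tree
(`exists_intertwiner_adjoint_of_hilbertSchmidt_le`, `HilbertRepTraceComparison`;
`jacquetLanglands_transfer_surjective_of_hilbertSchmidtComparison`,
`JacquetLanglandsSurjectiveOfTraceComparison`; per-constituent and fixed-ramified-factor forms in
`JacquetLanglandsSurjectivePerConstituent`, `JacquetLanglandsSurjectiveRamifiedFactor`; the passage
from a matched `*`-algebra of test functions to operators in `TraceComparisonDatumOfTestAlgebra`).
This file names step 1 — the analytic residual — as a fact of its own and records the assembly: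

* `jacquetLanglands_surjective_traceComparisonDatum` — for some family of splittings
  `θ₀_v : D_v ≃ₐ M₂(K_v)` (`v ∉ Ram_f(D)`), every cuspidal `π` of `GL₂(𝔸_K)` with essentially
  square-integrable irreducible admissible local components at the `v ∈ Ram_f(D)` (`D` division,
  unramified at infinity) carries a Hilbert–Schmidt comparison datum on
  `L²(D_𝔸ˣ ⧸ ℝ_{>0} Dˣ) × π`: Gelbart's (10.10) in the form `‖τ(f)|_π‖²_HS ≤ ‖τ'(f)‖²_HS < ∞` along a
  `*`-closed, product-closed, translation-stable family, with one member non-zero on `π`;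
* `jacquetLanglands_transfer_surjective_holds_of` — the assembly (Lemma 10.6), a direct call to
  `jacquetLanglands_transfer_surjective_of_hilbertSchmidtComparison`.

## References

* [Gelbart1975] S. Gelbart, *Automorphic forms on adele groups*, Ann. of Math. Studies 83 (1975),
  Thm. 10.5 (ii), Lemma 10.6, (10.8)–(10.22), pp. 148–156.
* [JacquetLanglands1970] H. Jacquet, R. P. Langlands, *Automorphic forms on `GL(2)`*, LNM 114
  (1970), §16, Thm. 16.1, Lemma 16.1.1.
-/

noncomputable section

open scoped TensorProduct MatrixGroups NNReal ENNReal InnerProductSpace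
open NumberField IsDedekindDomain MeasureTheory TopologicalSpace
open Literature.NumberTheory.Automorphic

universe u

namespace Literature.NumberTheory.Automorphic

section Split

variable (K : Type) [Field K] [NumberField K] (D : Type u) [Ring D] [Algebra K D]
  [IsQuaternionAlgebra K D]

-- Binder repair (2026-08-16): the header instance deliberately shadows the section's, which a
-- `def` does not capture (it ranged too widely before); the overlapping-instances linter is moot.
set_option linter.overlappingInstances false in
/-- **Gelbart (1975), (10.10) for a cuspidal constituent, Hilbert–Schmidt form — the analytic
residual of Thm. 10.5 (ii).** For some family of algebra splittings `θ₀_v : D_v ≃ₐ[K_v] M₂(K_v)` at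
the finite places `v ∉ Ram_f(D)` (they exist by definition of `Ram_f(D)`; any choice will do), the
following holds. Let `D` be a division quaternion algebra over `K` unramified at every infinite
place, `μ_D`, `μ` automorphic measures, `ν_v` Haar measures on `PGL₂(K_v)`, and `π` a cuspidal
automorphic representation of `GL₂(𝔸_K)` having at each `v ∈ Ram_f(D)` an irreducible admissible
local component which is essentially discrete series. Then there are Hilbert bases `(b_i)` of
`L²(D_𝔸ˣ ⧸ ℝ_{>0} Dˣ)` and `(c_j)` of `π`, and a `ℂ`-subspace `B` of
`𝓑(L²(D_𝔸ˣ ⧸ ℝ_{>0} Dˣ)) × 𝓑(π)` — in the printed proof the pairs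
`(R'(Φ'_f), R₀(Φ_f)|_π)`, `Φ_f = ξ_S ⊗ f`, `Φ'_f = ξ'_S ⊗ f`, `f ∈ C_c^∞(G^S)` ((10.11)–(10.13)) —
closed under products and adjoints and under left multiplication by every matched pair of local
translations `(R_D(ι_v θ₀_v⁻¹ g), π(ι_v g))`, `g ∈ GL₂(K_v)`, `v ∉ Ram_f(D)` finite, such that
`Σ_j ‖f₂ c_j‖² ≤ Σ_i ‖f₁ b_i‖² < ∞` for all `(f₁, f₂) ∈ B` — the trace identity (10.10)
`tr τ(f ⋆ f^*) = tr τ'(f ⋆ f^*)` (comparison (10.14) = (10.15) via (10.16)–(10.22) and the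
character identity (10.8)), in Hilbert–Schmidt form and cut down to `π`
(`‖R₀(Φ)|_π‖_HS ≤ ‖R₀(Φ)‖_HS`) — and some `(f₁, f₂) ∈ B` has `f₂ ≠ 0` (the `σ_S`-isotypic part of
`π` is non-zero: local theory at `S`, Thm. 7.6, "`M ∩ π ≠ 0`", p. 152). In-tree tools for a proof:
`exists_comparisonDatum_of_testAlgebra` (`TraceComparisonDatumOfTestAlgebra`) turns a matched
`*`-algebra of test-function pairs with the trace inequality into such a `B`;
`exists_discreteAutomorphicRep_of_localFactors` (`JacquetLanglandsSurjectiveRamifiedFactor`)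
isolates the non-vanishing input; the `D`-side Hilbert–Schmidt property is
`AdelicGroupData.hasSum_norm_sq_integratedOperator_rightRegular`.
[cite: Gelbart1975, (10.10)–(10.13) and (10.14)–(10.22), proof of Thm. 10.5 (ii), pp. 151–156]
(Binder repair 2026-08-16: `[IsQuaternionAlgebra K D]` is written in the header so that it is a
parameter of the elaborated constant; as a section instance unused by the body it was silently
dropped, so the fact ranged over cases the printed theorem excludes.) -/
def jacquetLanglands_surjective_traceComparisonDatum [IsQuaternionAlgebra K D] : Prop :=
  ∃ θ₀ : (∀ v, v ∉ ramifiedPlaces K D →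
      (ScalarExtension K (v.adicCompletion K) D ≃ₐ[v.adicCompletion K]
        Matrix (Fin 2) (Fin 2) (v.adicCompletion K))),
    ∀ (_hdiv : ∀ x : D, x ≠ 0 → IsUnit x)
      (μ_D : Measure (AdelicGroupData.units K D).automorphicQuotient)
      [(AdelicGroupData.units K D).IsAutomorphicMeasure μ_D]
      (μ : Measure (AdelicGroupData.gl 2 K).automorphicQuotient)
      [(AdelicGroupData.gl 2 K).IsAutomorphicMeasure μ]
      [∀ v : HeightOneSpectrum (𝓞 K), MeasurableSpace (GL (Fin 2) (v.adicCompletion K) ⧸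
        Subgroup.center (GL (Fin 2) (v.adicCompletion K)))]
      [∀ v : HeightOneSpectrum (𝓞 K), BorelSpace (GL (Fin 2) (v.adicCompletion K) ⧸
        Subgroup.center (GL (Fin 2) (v.adicCompletion K)))]
      (ν : ∀ v : HeightOneSpectrum (𝓞 K), Measure (GL (Fin 2) (v.adicCompletion K) ⧸
        Subgroup.center (GL (Fin 2) (v.adicCompletion K))))
      [∀ v, (ν v).IsHaarMeasure],
      ramifiedInfinitePlaces K D = ∅ →
      ∀ π : CuspidalAutomorphicRepGL 2 K μ,
        (∀ v ∈ ramifiedPlaces K D, ∃ (V : Type) (_ : AddCommGroup V) (_ : Module ℂ V)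
            (ρ : Representation ℂ (GL (Fin 2) (v.adicCompletion K)) V),
            ρ.IsIrreducible ∧ ρ.IsAdmissible ∧ HasLocalComponentAt π.1 v ρ ∧
              ρ.IsEssentiallyDiscreteSeries (ν v)) →
        ∃ (w₁ : Set ((AdelicGroupData.units K D).L2 μ_D))
          (b : HilbertBasis w₁ ℂ ((AdelicGroupData.units K D).L2 μ_D))
          (w₂ : Set π.1.toSubmodule) (c : HilbertBasis w₂ ℂ π.1.toSubmodule)
          (B : Submodule ℂ
            (((AdelicGroupData.units K D).L2 μ_D →L[ℂ] (AdelicGroupData.units K D).L2 μ_D) ×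
              (π.1.toSubmodule →L[ℂ] π.1.toSubmodule))),
          (∀ f ∈ B, ∀ h ∈ B, f * h ∈ B) ∧ (∀ f ∈ B, star f ∈ B) ∧
          (∀ (v : HeightOneSpectrum (𝓞 K)) (hv : v ∉ ramifiedPlaces K D)
              (g : GL (Fin 2) (v.adicCompletion K)), ∀ f ∈ B,
            (((AdelicGroupData.units K D).rightRegular μ_D
                (Quat.ofLocal K D v ((unitsEquivOfSplitting (θ₀ v hv)).symm g)),
              π.1.toContRep (GLn.ofLocal 2 K v g)) :
              ((AdelicGroupData.units K D).L2 μ_D →L[ℂ] (AdelicGroupData.units K D).L2 μ_D) ×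
                (π.1.toSubmodule →L[ℂ] π.1.toSubmodule)) * f ∈ B) ∧
          (∀ f ∈ B, ∑' j, (‖f.2 (c j)‖₊ : ℝ≥0∞) ^ 2 ≤ ∑' i, (‖f.1 (b i)‖₊ : ℝ≥0∞) ^ 2) ∧
          (∀ f ∈ B, ∑' i, (‖f.1 (b i)‖₊ : ℝ≥0∞) ^ 2 < ∞) ∧
          ∃ f ∈ B, f.2 ≠ 0

/-- **Assembly (Gelbart (1975), proof of Thm. 10.5 (ii) via Lemma 10.6): the "onto" half of
Jacquet–Langlands from the trace-comparison datum.** Unpack the splittings and apply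
`jacquetLanglands_transfer_surjective_of_hilbertSchmidtComparison` (Lemma 10.6 = JL Lemma 16.1.1,
proved in the tree as `exists_intertwiner_adjoint_of_hilbertSchmidt_le`).
[cite: Gelbart1975, Thm. 10.5 (ii) (proof), Lemma 10.6] -/
theorem jacquetLanglands_transfer_surjective_holds_of
    (h : jacquetLanglands_surjective_traceComparisonDatum K D) :
    jacquetLanglands_transfer_surjective K D := by
  obtain ⟨θ₀, hB⟩ := h
  exact jacquetLanglands_transfer_surjective_of_hilbertSchmidtComparison K D θ₀ hB

end Split

end Literature.NumberTheory.Automorphic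

end
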